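import Literature.Analysis.ValidatedNumerics.RBoxInfeasibility
import HarnessLib

/-!
# `RobustTangencyBound` — infeasibility of a box from its two halves (certificate pieces, step (III))

Route `TwoCentreKissingKernel`, item `stmt-AtomisticToContinuum-12082`, blueprint (III) §11.  Large kd-tree certificates are checked
piecewise: the box of an `RInfeasClaim` is bisected (`Box.split`) a few times by the generator
(`work/factory/factory.py split_pieces`), every piece carries its own kernel certificate, and the
pieces are reassembled with `rinfeas_holds_of_split` (`Box.mem_split`: the two halves cover).
-/

namespace Summit.AtomisticToContinuum.Crystallization.Theorems

open Literature.Analysis.ValidatedNumerics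

/-- **Infeasibility of a box from the infeasibility of its two halves.** -/
theorem rinfeas_holds_of_split (gs hs : List RExpr) (B : Box) (axis : ℕ) (c : ℚ)
    (h1 : (⟨gs, hs, (B.split axis c).1⟩ : RInfeasClaim).Holds)
    (h2 : (⟨gs, hs, (B.split axis c).2⟩ : RInfeasClaim).Holds) : (⟨gs, hs, B⟩ : RInfeasClaim).Holds :=
  fun x hx => (Box.mem_split hx axis c).elim (h1 x) (h2 x)

end Summit.AtomisticToContinuum.Crystallization.Theorems
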